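import Summits.BirchSwinnertonDyer.BirchSwinnertonDyer.Theorems.CMKolyvaginAtInertTwoPairDataAtTwo
import HarnessLib

/-!
# Route `CMKolyvaginAtInertTwo`, crux `CMKolyvaginExactAtInertTwo` (stmt-BirchSwinnertonDyer-24277):
# THE INPUTS `hxε`, `hx` OF THE INSTANCE `pairData` FROM THE ITEM'S `M₀`-CLAUSE (no `2`-torsion in `E(K)`)

Seat `bsd-line-cmk2-p1` g13 (cell `bsd-print-cf2`); helper (`--supports stmt-BirchSwinnertonDyer-24277`).
THEOREMS ONLY: no definition, no named fact, no `sorry`; no item is closed; BSD is not proved by this.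

The concrete split data `KolyvaginPairDataTwo.pairData` (p675421) takes a point `x₀ ∈ E(K)` with
`2^{M₀} x₀ = P` (`P = y_K`), and two hypotheses: `hxε` (the Kummer class `δ x₀` is an `ε`-eigenclass
of the conjugation) and `hx` (`2^M Q ≠ 2^{M−1} x₀` for all `Q ∈ E(K)`). On the habitat `E(K)[2] = 0`
(g0's `CMExactDescent.eq_zero_of_two_smul_eq_zero_baseChange`), both follow from the item's currency:
* `zsmul_ne_of_not_two_pow_succ_divisible` — `hx` from "`2^{M₀+1} ∤ P` in `E(K)`" (McCallum Lemma 5.1: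
  `2^{M₀} ∥ y_K`): if `2^M Q = 2^{M−1} x₀` then `2^{M−1}(2Q − x₀) = 0`, so `x₀ = 2Q` and
  `P = 2^{M₀+1} Q`;
* `conjAct_kummerMapTorsion_eq_smul_of_isOfFinAddOrder` — `hxε` from Gross's Prop. 5.3 at `m = 1`
  (`c P − ε P` torsion, the field `conj_sub_torsion` of ty2's `PointSystem`): `t = c x₀ − ε x₀` has
  `2^{M₀} t` torsion, hence is torsion, hence of ODD order (no `2`-torsion), hence `2^M`-divisible, so
  `δ t = 0` and `c_* δ x₀ = δ(c x₀) = ε δ x₀ + δ t`.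
References: [McCallumLMS1991] §5 Lemma 5.1; [GrossLMS1991] Prop. 5.3, §4 (4.1).
-/

-- single-conjunct summit: `Summit.BirchSwinnertonDyer.BirchSwinnertonDyer.…` repeats the name by design
set_option linter.dupNamespace false
set_option autoImplicit false

noncomputable section

open scoped Classical
open WeierstrassCurve NumberField
open Literature.NumberTheory.GaloisRepresentations
open Literature.NumberTheory.EllipticCurves Literature.NumberTheory.EllipticCurves.KolyvaginDescent

namespace Summit.BirchSwinnertonDyer.BirchSwinnertonDyer.Theorems.KolyvaginPairDataTwo

section NoTwoTorsion

variable {A : Type*} [AddCommGroup A]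

/-- No `2`-torsion ⟹ no `2^n`-torsion. [folklore] -/
theorem eq_zero_of_two_pow_zsmul_eq_zero (h2 : ∀ T : A, (2 : ℤ) • T = 0 → T = 0) :
    ∀ (n : ℕ) (T : A), ((2 : ℤ) ^ n) • T = 0 → T = 0 := by
  intro n
  induction n with
  | zero => intro T hT; rwa [pow_zero, one_zsmul] at hT
  | succ n ih =>
    intro T hT
    rw [pow_succ, mul_zsmul] at hT
    exact h2 T (ih _ hT)

/-- No `2`-torsion ⟹ every torsion element has ODD order. [folklore] -/
theorem odd_addOrderOf_of_isOfFinAddOrder (h2 : ∀ T : A, (2 : ℤ) • T = 0 → T = 0) {t : A}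
    (ht : IsOfFinAddOrder t) : Odd (addOrderOf t) := by
  rcases Nat.even_or_odd (addOrderOf t) with he | ho
  swap
  · exact ho
  · exfalso
    obtain ⟨k, hk⟩ := he
    have hpos : 0 < addOrderOf t := ht.addOrderOf_pos
    have hk0 : k ≠ 0 := by rintro rfl; omega
    have hkt : k • t ≠ 0 := fun h ↦ by
      have := addOrderOf_dvd_of_nsmul_eq_zero h
      have hle := Nat.le_of_dvd (Nat.pos_of_ne_zero hk0) this
      omega
    apply hkt
    apply h2
    rw [← natCast_zsmul, ← mul_zsmul, show (2 : ℤ) * (k : ℤ) = ((addOrderOf t : ℕ) : ℤ) by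
      rw [hk]; push_cast; ring, natCast_zsmul, addOrderOf_nsmul_eq_zero]

/-- No `2`-torsion ⟹ every torsion element is `2^M`-divisible (indeed a `2^M`-multiple of one of its
own multiples). [folklore] -/
theorem exists_two_pow_zsmul_eq_of_isOfFinAddOrder (h2 : ∀ T : A, (2 : ℤ) • T = 0 → T = 0) {t : A}
    (ht : IsOfFinAddOrder t) (M : ℕ) : ∃ u : ℤ, ((2 : ℤ) ^ M) • (u • t) = t := by
  have hodd := odd_addOrderOf_of_isOfFinAddOrder h2 ht
  set m := addOrderOf t with hm
  by_cases hm1 : m = 1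
  · refine ⟨0, ?_⟩
    have : t = 0 := AddMonoid.addOrderOf_eq_one_iff.mp hm1
    rw [this, zsmul_zero, zsmul_zero]
  have hm1' : 1 < m := by
    have := ht.addOrderOf_pos
    omega
  have hcop : Nat.Coprime (2 ^ M) m := (Nat.coprime_two_left.mpr hodd).pow_left M
  obtain ⟨u, -, hu⟩ := Nat.exists_mul_mod_eq_one_of_coprime hcop hm1'
  refine ⟨u, ?_⟩
  have hcast : ((2 : ℤ) ^ M * (u : ℤ)) = ((2 ^ M * u : ℕ) : ℤ) := by push_cast; ring
  rw [smul_smul, hcast, natCast_zsmul, ← Nat.div_add_mod (2 ^ M * u) m, hu,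
    add_nsmul, mul_nsmul, addOrderOf_nsmul_eq_zero, nsmul_zero, zero_add, one_nsmul]

end NoTwoTorsion

section Inputs

variable (W : WeierstrassCurve ℚ) {K : Type} [Field K] [NumberField K]

/-- **`hx` from the `M₀`-clause (McCallum Lemma 5.1 `2^{M₀} ∥ y_K`).** If `E(K)` has no `2`-torsion,
`2^{M₀} x₀ = P` and `P ∉ 2^{M₀+1} E(K)`, then for `M ≥ 1` no `Q ∈ E(K)` has `2^M Q = 2^{M−1} x₀`.
[cite: McCallumLMS1991, §5 Lemma 5.1] -/
theorem zsmul_ne_of_not_two_pow_succ_divisible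
    (h2 : ∀ T : (W.baseChange K).toAffine.Point, (2 : ℤ) • T = 0 → T = 0)
    {x₀ P : (W.baseChange K).toAffine.Point} {M₀ M : ℕ} (hM : 1 ≤ M)
    (hP : (((2 : ℕ) : ℤ) ^ M₀) • x₀ = P)
    (hnd : ∀ Q : (W.baseChange K).toAffine.Point, (((2 : ℕ) : ℤ) ^ (M₀ + 1)) • Q ≠ P) :
    ∀ Q : (W.baseChange K).toAffine.Point, ((2 ^ M : ℕ) : ℤ) • Q ≠ (((2 : ℕ) : ℤ) ^ (M - 1)) • x₀ := by
  intro Q hQ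
  -- `2^{M-1} (2Q - x₀) = 0`, so `x₀ = 2Q`
  have hk : ((2 : ℤ) ^ (M - 1)) • ((2 : ℤ) • Q - x₀) = 0 := by
    rw [zsmul_sub, smul_smul, ← pow_succ, Nat.sub_add_cancel hM, sub_eq_zero]
    have : ((2 ^ M : ℕ) : ℤ) = (2 : ℤ) ^ M := by push_cast; ring
    rw [← this, hQ]
    norm_num
  have hx₀ : x₀ = (2 : ℤ) • Q := (sub_eq_zero.mp (eq_zero_of_two_pow_zsmul_eq_zero h2 _ _ hk)).symm
  apply hnd Q
  rw [← hP, hx₀, smul_smul, pow_succ]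
  norm_num

/-- **`hxε` from Gross's Prop. 5.3 at `m = 1`.** If `E(K)` has no `2`-torsion, `2^{M₀} x₀ = P` and
`c P − ε P` is torsion (the field `conj_sub_torsion` of a point system), then the Kummer class of
`x₀` at any level `n` with `E(K̄)` `n`-divisible and `n = 2^M` is an `ε`-eigenclass of `c_*`:
`c_* δ x₀ = ε δ x₀`. [cite: GrossLMS1991, Prop. 5.3, §4 (4.1)] -/
theorem conjAct_kummerMapTorsion_eq_smul_of_isOfFinAddOrder
    (h2 : ∀ T : (W.baseChange K).toAffine.Point, (2 : ℤ) • T = 0 → T = 0)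
    (c : K ≃ₐ[ℚ] K) {M : ℕ}
    (hdiv : ∀ Q : geomPoints (W.baseChange K), ∃ R, ((2 ^ M : ℕ) : ℤ) • R = Q)
    {x₀ P : (W.baseChange K).toAffine.Point} {M₀ : ℕ} (hP : (((2 : ℕ) : ℤ) ^ M₀) • x₀ = P) {ε : ℤ}
    (htor : IsOfFinAddOrder (Affine.Point.map (W' := W) (c : K →ₐ[ℚ] K) P - ε • P)) :
    conjAct W c ((2 ^ M : ℕ) : ℤ) (kummerMapTorsion (W.baseChange K) _ hdiv x₀) =
      ε • kummerMapTorsion (W.baseChange K) _ hdiv x₀ := by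
  set t : (W.baseChange K).toAffine.Point := Affine.Point.map (W' := W) (c : K →ₐ[ℚ] K) x₀ - ε • x₀
    with htdef
  -- `2^{M₀} t = c P - ε P` is torsion, hence so is `t`
  have hmul : (((2 : ℕ) : ℤ) ^ M₀) • t = Affine.Point.map (W' := W) (c : K →ₐ[ℚ] K) P - ε • P := by
    rw [htdef, zsmul_sub, ← map_zsmul, hP, smul_comm, hP]
  have httor : IsOfFinAddOrder t := by
    obtain ⟨k, hk, hk0⟩ := (isOfFinAddOrder_iff_nsmul_eq_zero).mp htor
    rw [← hmul, ← natCast_zsmul, smul_smul] at hk0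
    rw [isOfFinAddOrder_iff_zsmul_eq_zero]
    refine ⟨(k : ℤ) * ((2 : ℕ) : ℤ) ^ M₀, ?_, hk0⟩
    exact mul_ne_zero (by exact_mod_cast hk.ne') (pow_ne_zero _ (by norm_num))
  -- `t` is `2^M`-divisible in `E(K)`, so its Kummer class vanishes
  obtain ⟨u, hu⟩ := exists_two_pow_zsmul_eq_of_isOfFinAddOrder h2 httor M
  have hδt : kummerMapTorsion (W.baseChange K) _ hdiv t = 0 := by
    rw [← hu, show ((2 : ℤ) ^ M) = ((2 ^ M : ℕ) : ℤ) by push_cast; ring, map_zsmul]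
    exact zsmul_galH1Torsion_eq_zero _ _ _
  -- `c_* δ x₀ = δ (c x₀) = δ (ε x₀ + t) = ε δ x₀`
  rw [conjAct_kummerMapTorsion]
  have hcx : Affine.Point.map (W' := W) (c : K →ₐ[ℚ] K) x₀ = ε • x₀ + t := by rw [htdef]; abel
  rw [hcx, map_add, map_zsmul, hδt, add_zero]

end Inputs

end Summit.BirchSwinnertonDyer.BirchSwinnertonDyer.Theorems.KolyvaginPairDataTwo
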